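import Mathlib.MeasureTheory.Measure.Prokhorov
import Mathlib.MeasureTheory.Integral.Bochner.Basic
import Mathlib.MeasureTheory.Measure.WithDensity
import Mathlib.Analysis.SpecialFunctions.Exp
import Mathlib.Topology.ContinuousMap.Bounded.Normed
import HarnessLib

/-!
# Damped Laplace kernels and weak limits of damped orthant measures

Helper file 1/2 for item stmt-CriticalPhenomena-8368 (`LimitKernelGSM`, route GaussianScaleMixture,
sub-problem Ising3DConformalLimit): the measure-theoretic engine behind "pointwise limits of
Laplace transforms of finite orthant measures are Laplace transforms"
(`GaussianScaleMixtureLimitKernelGSMLaplace.lean`).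

For finite measures `μ a` on `ℝ^ι` (`ι` finite) carried by the closed orthant
`{s | ∀ i, 0 ≤ s i}` whose Laplace transforms `∫ exp(-∑ sᵢvᵢ) dμ_a` converge (along a filter `l`)
at every `v ≥ 0`, `v ≠ 0`, the DAMPED measures `exp(-ε ∑ max(sᵢ,0)) · μ_a` (`ε > 0`) have
eventually bounded mass and uniformly small tails (both controlled by the transforms at `ε𝟙` and
`(ε/2)𝟙`), so by Prokhorov's theorem (`isCompact_setOf_finiteMeasure_mass_le_compl_isCompact_le`)
they converge weakly along the ultrafilter `Ultrafilter.of l` to a finite measure carried by the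
orthant (`exists_limit_damp`).

Also here: the rounding arithmetic of `t ↦ ⌊c t / δ⌋` used by the lattice-to-Laplace limit
(`abs_div_le_abs_floor`, `abs_floor_le_abs_div`, `exists_pos_le_abs_of_ne_zero`).

Design: no new definitions — the bounded kernel `s ↦ exp(-∑ max(sᵢ,0) uᵢ)` (equal to the Laplace
kernel on the orthant, `≤ 1` for `u ≥ 0`) and the damped measures are written inline.

References: Berg–Christensen–Ressel, *Harmonic Analysis on Semigroups* (1984), §4.6, for the
classical (Bernstein–Widder) route, which is NOT used here.
-/

noncomputable section

namespace Summit.CriticalPhenomena.Ising3DConformalLimit.Theorems.LimitKernelGSM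

open MeasureTheory Filter Topology Set
open scoped ENNReal NNReal BoundedContinuousFunction

variable {ι : Type*} [Fintype ι]

/-! ## The bounded Laplace kernel `exp(-∑ max(sᵢ,0) uᵢ)` -/

/-- Continuity of the bounded Laplace kernel. [folklore] -/
theorem continuous_kerB (u : ι → ℝ) :
    Continuous fun s : ι → ℝ => Real.exp (-∑ i, max (s i) 0 * u i) := by
  fun_prop

/-- The bounded Laplace kernel is at most `1` for `u ≥ 0`. [folklore] -/
theorem kerB_le_one {u : ι → ℝ} (hu : ∀ i, 0 ≤ u i) (s : ι → ℝ) :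
    Real.exp (-∑ i, max (s i) 0 * u i) ≤ 1 := by
  rw [Real.exp_le_one_iff, neg_nonpos]
  exact Finset.sum_nonneg fun i _ => mul_nonneg (le_max_right _ _) (hu i)

/-- Multiplicativity of the bounded Laplace kernel in the dual variable. [folklore] -/
theorem kerB_add (u w s : ι → ℝ) :
    Real.exp (-∑ i, max (s i) 0 * (u i + w i)) =
      Real.exp (-∑ i, max (s i) 0 * u i) * Real.exp (-∑ i, max (s i) 0 * w i) := by
  rw [← Real.exp_add]
  congr 1
  simp only [mul_add, Finset.sum_add_distrib]
  ring

/-- On the orthant the bounded kernel is the Laplace kernel `exp(-∑ sᵢuᵢ)`. [folklore] -/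
theorem kerB_eq_of_nonneg (u : ι → ℝ) {s : ι → ℝ} (hs : ∀ i, 0 ≤ s i) :
    Real.exp (-∑ i, max (s i) 0 * u i) = Real.exp (-∑ i, s i * u i) := by
  congr 2
  exact Finset.sum_congr rfl fun i _ => by rw [max_eq_left (hs i)]

/-- The bounded Laplace kernel as a bounded continuous function (for `u ≥ 0`). [folklore] -/
theorem exists_bcf_kerB {u : ι → ℝ} (hu : ∀ i, 0 ≤ u i) :
    ∃ f : (ι → ℝ) →ᵇ ℝ, ∀ s, f s = Real.exp (-∑ i, max (s i) 0 * u i) :=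
  ⟨BoundedContinuousFunction.ofNormedAddCommGroup _ (continuous_kerB u) 1 fun s => by
      rw [Real.norm_eq_abs, abs_of_pos (Real.exp_pos _)]; exact kerB_le_one hu s,
    fun _ => rfl⟩

/-- The bounded kernel is integrable against every finite measure (`u ≥ 0`). [folklore] -/
theorem integrable_kerB (m : Measure (ι → ℝ)) [IsFiniteMeasure m] {u : ι → ℝ} (hu : ∀ i, 0 ≤ u i) :
    Integrable (fun s : ι → ℝ => Real.exp (-∑ i, max (s i) 0 * u i)) m := by
  refine Integrable.mono' (integrable_const (1 : ℝ)) (continuous_kerB u).aestronglyMeasurable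
    (Eventually.of_forall fun s => ?_)
  rw [Real.norm_eq_abs, abs_of_pos (Real.exp_pos _)]
  exact kerB_le_one hu s

omit [Fintype ι] in
/-- A measure carried by the orthant sees only nonnegative coordinates. [folklore] -/
theorem ae_nonneg_of_compl_null {m : Measure (ι → ℝ)} (hm : m {s | ∃ i, s i < 0} = 0) :
    ∀ᵐ s ∂m, ∀ i, 0 ≤ s i := by
  rw [ae_iff]
  have : {a : ι → ℝ | ¬∀ i, 0 ≤ a i} = {s | ∃ i, s i < 0} := by ext s; simp [not_le]
  rw [this]; exact hm

/-- For an orthant measure the bounded kernel integrates like the Laplace kernel. [folklore] -/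
theorem integral_kerB_eq {m : Measure (ι → ℝ)} (hm : m {s | ∃ i, s i < 0} = 0) (u : ι → ℝ) :
    ∫ s, Real.exp (-∑ i, max (s i) 0 * u i) ∂m = ∫ s, Real.exp (-∑ i, s i * u i) ∂m :=
  integral_congr_ae <| (ae_nonneg_of_compl_null hm).mono fun _ hs => kerB_eq_of_nonneg u hs

/-! ## Orthant slabs `{s ≥ 0, ∑ sᵢ ≤ R}` -/

/-- The orthant slabs are closed. [folklore] -/
theorem isClosed_orthantSlab (R : ℝ) : IsClosed {s : ι → ℝ | (∀ i, 0 ≤ s i) ∧ ∑ i, s i ≤ R} := by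
  have h1 : IsClosed {s : ι → ℝ | ∀ i, 0 ≤ s i} := by
    rw [Set.setOf_forall]
    exact isClosed_iInter fun i => isClosed_le continuous_const (continuous_apply i)
  exact h1.inter (isClosed_le (continuous_finsetSum _ fun i _ => continuous_apply i) continuous_const)

/-- The orthant slabs are compact. [folklore] -/
theorem isCompact_orthantSlab (R : ℝ) : IsCompact {s : ι → ℝ | (∀ i, 0 ≤ s i) ∧ ∑ i, s i ≤ R} := by
  refine (isCompact_Icc (a := (0 : ι → ℝ)) (b := fun _ => R)).of_isClosed_subset
    (isClosed_orthantSlab R) ?_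
  intro s hs
  exact ⟨fun i => hs.1 i, fun i =>
    (Finset.single_le_sum (fun j _ => hs.1 j) (Finset.mem_univ i)).trans hs.2⟩

/-! ## Damped measures `exp(-ε ∑ max(sᵢ,0)) · m` -/

/-- Integration against a measure with a continuous nonnegative real density. [folklore] -/
theorem integral_withDensity_ofReal_continuous (m : Measure (ι → ℝ)) {w : (ι → ℝ) → ℝ}
    (hw : Continuous w) (hw0 : ∀ s, 0 ≤ w s) (g : (ι → ℝ) → ℝ) :
    ∫ s, g s ∂(m.withDensity fun s => ENNReal.ofReal (w s)) = ∫ s, w s * g s ∂m := by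
  have hmeas : Measurable fun s => Real.toNNReal (w s) := hw.measurable.real_toNNReal
  have := integral_withDensity_eq_integral_smul hmeas g (μ := m)
  simp only [NNReal.smul_def, smul_eq_mul, Real.coe_toNNReal _ (hw0 _)] at this
  exact this

/-- Integrability against a measure with a continuous nonnegative real density. [folklore] -/
theorem integrable_withDensity_ofReal_continuous (m : Measure (ι → ℝ)) {w : (ι → ℝ) → ℝ}
    (hw : Continuous w) (hw0 : ∀ s, 0 ≤ w s) (g : (ι → ℝ) → ℝ) :
    Integrable g (m.withDensity fun s => ENNReal.ofReal (w s)) ↔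
      Integrable (fun s => w s * g s) m := by
  have hmeas : Measurable fun s => Real.toNNReal (w s) := hw.measurable.real_toNNReal
  have := integrable_withDensity_iff_integrable_smul hmeas (g := g) (μ := m)
  simp only [NNReal.smul_def, smul_eq_mul, Real.coe_toNNReal _ (hw0 _)] at this
  exact this

/-- Integration against the damped measure. [folklore] -/
theorem integral_damp (m : Measure (ι → ℝ)) (ε : ℝ) (g : (ι → ℝ) → ℝ) :
    ∫ s, g s ∂(m.withDensity fun s => ENNReal.ofReal (Real.exp (-∑ i, max (s i) 0 * ε))) =
      ∫ s, Real.exp (-∑ i, max (s i) 0 * ε) * g s ∂m :=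
  integral_withDensity_ofReal_continuous m (continuous_kerB fun _ => ε)
    (fun _ => (Real.exp_pos _).le) g

/-- The damped measure of a finite measure is finite (`ε ≥ 0`). [folklore] -/
theorem isFiniteMeasure_damp (m : Measure (ι → ℝ)) [IsFiniteMeasure m] {ε : ℝ} (hε : 0 ≤ ε) :
    IsFiniteMeasure (m.withDensity fun s => ENNReal.ofReal (Real.exp (-∑ i, max (s i) 0 * ε))) :=
  isFiniteMeasure_withDensity_ofReal (integrable_kerB m (fun _ => hε)).hasFiniteIntegral

/-- Total mass of the damped measure, as an integral. [folklore] -/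
theorem damp_univ (m : Measure (ι → ℝ)) [IsFiniteMeasure m] {ε : ℝ} (hε : 0 ≤ ε) :
    (m.withDensity fun s => ENNReal.ofReal (Real.exp (-∑ i, max (s i) 0 * ε))) univ =
      ENNReal.ofReal (∫ s, Real.exp (-∑ i, max (s i) 0 * ε) ∂m) := by
  rw [withDensity_apply _ MeasurableSet.univ, Measure.restrict_univ,
    ofReal_integral_eq_lintegral_ofReal (integrable_kerB m (fun _ => hε))
      (Eventually.of_forall fun s => (Real.exp_pos _).le)]

/-- Tail of the damped measure: the mass of `{∑ sᵢ > R}` (inside the orthant) is at most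
`exp(-ε R / 2) · ∫ exp(-(ε/2) ∑ max(sᵢ,0)) dm`. [folklore] -/
theorem damp_tail_le (m : Measure (ι → ℝ)) [IsFiniteMeasure m] (hm : m {s | ∃ i, s i < 0} = 0)
    {ε : ℝ} (hε : 0 ≤ ε) (R : ℝ) :
    (m.withDensity fun s => ENNReal.ofReal (Real.exp (-∑ i, max (s i) 0 * ε)))
        {s | (∀ i, 0 ≤ s i) ∧ ∑ i, s i ≤ R}ᶜ ≤
      ENNReal.ofReal (Real.exp (-(ε / 2 * R)) * ∫ s, Real.exp (-∑ i, max (s i) 0 * (ε / 2)) ∂m) := by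
  have hKc : MeasurableSet {s : ι → ℝ | (∀ i, 0 ≤ s i) ∧ ∑ i, s i ≤ R}ᶜ :=
    (isClosed_orthantSlab R).measurableSet.compl
  rw [withDensity_apply _ hKc]
  have hae := ae_nonneg_of_compl_null hm
  calc ∫⁻ s in {s : ι → ℝ | (∀ i, 0 ≤ s i) ∧ ∑ i, s i ≤ R}ᶜ,
          ENNReal.ofReal (Real.exp (-∑ i, max (s i) 0 * ε)) ∂m
        ≤ ∫⁻ s in {s : ι → ℝ | (∀ i, 0 ≤ s i) ∧ ∑ i, s i ≤ R}ᶜ,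
          ENNReal.ofReal (Real.exp (-(ε / 2 * R))) *
            ENNReal.ofReal (Real.exp (-∑ i, max (s i) 0 * (ε / 2))) ∂m := by
        refine setLIntegral_mono_ae ?_ ?_
        · exact ((continuous_kerB (fun _ => ε / 2)).measurable.ennreal_ofReal.const_mul _).aemeasurable
        · refine hae.mono fun s hs hsK => ?_
          rw [← ENNReal.ofReal_mul (Real.exp_pos _).le, ← Real.exp_add]
          refine ENNReal.ofReal_le_ofReal (Real.exp_le_exp.2 ?_)
          have hsum : R < ∑ i, s i := by
            simp only [mem_compl_iff, mem_setOf_eq, not_and, not_le] at hsK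
            exact hsK hs
          have h1 : ∑ i, max (s i) 0 * ε = ε * ∑ i, s i := by
            rw [Finset.mul_sum]
            exact Finset.sum_congr rfl fun i _ => by rw [max_eq_left (hs i), mul_comm]
          have h2 : ∑ i, max (s i) 0 * (ε / 2) = ε / 2 * ∑ i, s i := by
            rw [Finset.mul_sum]
            exact Finset.sum_congr rfl fun i _ => by rw [max_eq_left (hs i), mul_comm]
          rw [h1, h2]
          nlinarith
    _ ≤ ∫⁻ s, ENNReal.ofReal (Real.exp (-(ε / 2 * R))) *
            ENNReal.ofReal (Real.exp (-∑ i, max (s i) 0 * (ε / 2))) ∂m :=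
        setLIntegral_le_lintegral _ _
    _ = ENNReal.ofReal (Real.exp (-(ε / 2 * R))) *
          ∫⁻ s, ENNReal.ofReal (Real.exp (-∑ i, max (s i) 0 * (ε / 2))) ∂m :=
        lintegral_const_mul _ (continuous_kerB (fun _ => ε / 2)).measurable.ennreal_ofReal
    _ = ENNReal.ofReal (Real.exp (-(ε / 2 * R)) *
          ∫ s, Real.exp (-∑ i, max (s i) 0 * (ε / 2)) ∂m) := by
        rw [ENNReal.ofReal_mul (Real.exp_pos _).le,
          ofReal_integral_eq_lintegral_ofReal (integrable_kerB m (fun _ => by positivity))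
            (Eventually.of_forall fun s => (Real.exp_pos _).le)]

/-! ## Weak limits of the damped family along an ultrafilter -/

section Limit

variable {α : Type*} {l : Filter α} (μ : α → Measure (ι → ℝ)) [∀ a, IsFiniteMeasure (μ a)]
  (Φ : (ι → ℝ) → ℝ)

/-- Mass and tails of the damped family are eventually controlled by two values of `Φ`. [folklore] -/
theorem eventually_mass_tail (hsupp : ∀ a, μ a {s | ∃ i, s i < 0} = 0)
    (hlim : ∀ v : ι → ℝ, (∀ i, 0 ≤ v i) → v ≠ 0 →
      Tendsto (fun a => ∫ s, Real.exp (-∑ i, s i * v i) ∂(μ a)) l (𝓝 (Φ v)))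
    [Nonempty ι] {ε : ℝ} (hε : 0 < ε) :
    ∀ᶠ a in l,
      (⟨(μ a).withDensity fun s => ENNReal.ofReal (Real.exp (-∑ i, max (s i) 0 * ε)),
          isFiniteMeasure_damp (μ a) hε.le⟩ : FiniteMeasure (ι → ℝ)) ∈
        {κ : FiniteMeasure (ι → ℝ) | κ.mass ≤ (Φ (fun _ => ε) + 1).toNNReal ∧
          ∀ n : ℕ, κ {s | (∀ i, 0 ≤ s i) ∧ ∑ i, s i ≤ (n : ℝ)}ᶜ ≤
            ((Φ (fun _ => ε / 2) + 1) * Real.exp (-(ε / 2 * n))).toNNReal} := by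
  have hne : ∀ {c : ℝ}, 0 < c → (fun _ : ι => c) ≠ 0 := fun {c} hc h =>
    hc.ne' (by simpa using congr_fun h (Classical.arbitrary ι))
  have h1 : ∀ᶠ a in l, ∫ s, Real.exp (-∑ i, s i * ε) ∂(μ a) < Φ (fun _ => ε) + 1 :=
    (tendsto_order.1 (hlim (fun _ => ε) (fun _ => hε.le) (hne hε))).2 _ (lt_add_one _)
  have h2 : ∀ᶠ a in l, ∫ s, Real.exp (-∑ i, s i * (ε / 2)) ∂(μ a) < Φ (fun _ => ε / 2) + 1 :=
    (tendsto_order.1 (hlim (fun _ => ε / 2) (fun _ => by positivity) (hne (by positivity)))).2 _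
      (lt_add_one _)
  filter_upwards [h1, h2] with a ha1 ha2
  have I1 : ∫ s, Real.exp (-∑ i, max (s i) 0 * ε) ∂(μ a) < Φ (fun _ => ε) + 1 := by
    rw [integral_kerB_eq (hsupp a)]; exact ha1
  have I2 : ∫ s, Real.exp (-∑ i, max (s i) 0 * (ε / 2)) ∂(μ a) < Φ (fun _ => ε / 2) + 1 := by
    rw [integral_kerB_eq (hsupp a)]; exact ha2
  refine ⟨?_, fun n => ?_⟩
  · rw [← ENNReal.coe_le_coe, FiniteMeasure.ennreal_mass]
    change ((μ a).withDensity fun s => ENNReal.ofReal (Real.exp (-∑ i, max (s i) 0 * ε))) univ ≤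
      ENNReal.ofReal _
    rw [damp_univ (μ a) hε.le]
    exact ENNReal.ofReal_le_ofReal I1.le
  · rw [← ENNReal.coe_le_coe, FiniteMeasure.ennreal_coeFn_eq_coeFn_toMeasure]
    change ((μ a).withDensity fun s => ENNReal.ofReal (Real.exp (-∑ i, max (s i) 0 * ε)))
        {s | (∀ i, 0 ≤ s i) ∧ ∑ i, s i ≤ (n : ℝ)}ᶜ ≤ ENNReal.ofReal _
    refine (damp_tail_le (μ a) (hsupp a) hε.le n).trans (ENNReal.ofReal_le_ofReal ?_)
    rw [mul_comm]
    exact mul_le_mul_of_nonneg_right I2.le (Real.exp_pos _).le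

/-- **Weak limit of the damped family.** Along the ultrafilter `Ultrafilter.of l` the damped measures
`exp(-ε∑max(sᵢ,0)) μ_a` converge weakly to a finite measure carried by the orthant (Prokhorov).
[folklore] -/
theorem exists_limit_damp [NeBot l] (hsupp : ∀ a, μ a {s | ∃ i, s i < 0} = 0)
    (hlim : ∀ v : ι → ℝ, (∀ i, 0 ≤ v i) → v ≠ 0 →
      Tendsto (fun a => ∫ s, Real.exp (-∑ i, s i * v i) ∂(μ a)) l (𝓝 (Φ v)))
    [Nonempty ι] {ε : ℝ} (hε : 0 < ε) :
    ∃ κ : FiniteMeasure (ι → ℝ),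
      Tendsto (β := FiniteMeasure (ι → ℝ)) (fun a => ⟨(μ a).withDensity fun s =>
          ENNReal.ofReal (Real.exp (-∑ i, max (s i) 0 * ε)), isFiniteMeasure_damp (μ a) hε.le⟩)
        (Ultrafilter.of l : Filter α) (𝓝 κ) ∧
      (κ : Measure (ι → ℝ)) {s | ∃ i, s i < 0} = 0 := by
  have hu : Tendsto (fun n : ℕ => (((Φ fun _ => ε / 2) + 1) * Real.exp (-(ε / 2 * n))).toNNReal)
      atTop (𝓝 0) := by
    have h : Tendsto (fun n : ℕ => (Φ (fun _ => ε / 2) + 1) * Real.exp (-(ε / 2 * n))) atTop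
        (𝓝 ((Φ (fun _ => ε / 2) + 1) * 0)) := by
      refine tendsto_const_nhds.mul (Real.tendsto_exp_atBot.comp ?_)
      exact tendsto_neg_atTop_atBot.comp
        (Tendsto.const_mul_atTop (by positivity) tendsto_natCast_atTop_atTop)
    rw [mul_zero] at h
    have h' := (continuous_real_toNNReal.tendsto (0 : ℝ)).comp h
    rw [Real.toNNReal_zero] at h'
    exact h'
  have hcpt := isCompact_setOf_finiteMeasure_mass_le_compl_isCompact_le (E := ι → ℝ)
    (u := fun n : ℕ => (((Φ fun _ => ε / 2) + 1) * Real.exp (-(ε / 2 * n))).toNNReal)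
    (K := fun n : ℕ => {s : ι → ℝ | (∀ i, 0 ≤ s i) ∧ ∑ i, s i ≤ (n : ℝ)})
    ((Φ (fun _ => ε) + 1).toNNReal) hu (fun n => isCompact_orthantSlab _) (Or.inl inferInstance)
  have hev := eventually_mass_tail μ Φ hsupp hlim hε
  let F : α → FiniteMeasure (ι → ℝ) := fun a => ⟨(μ a).withDensity fun s =>
    ENNReal.ofReal (Real.exp (-∑ i, max (s i) 0 * ε)), isFiniteMeasure_damp (μ a) hε.le⟩
  have hle : (↑((Ultrafilter.of l).map F) : Filter (FiniteMeasure (ι → ℝ))) ≤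
      𝓟 {κ | κ.mass ≤ (Φ (fun _ => ε) + 1).toNNReal ∧ ∀ n : ℕ,
        κ {s : ι → ℝ | (∀ i, 0 ≤ s i) ∧ ∑ i, s i ≤ (n : ℝ)}ᶜ ≤
          (((Φ fun _ => ε / 2) + 1) * Real.exp (-(ε / 2 * n))).toNNReal} := by
    rw [Ultrafilter.coe_map, le_principal_iff]
    exact Ultrafilter.of_le l hev
  obtain ⟨κ, hκ, hκle⟩ := hcpt.ultrafilter_le_nhds _ hle
  refine ⟨κ, ?_, ?_⟩
  · rw [Ultrafilter.coe_map] at hκle; exact hκle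
  · have h1 : ∀ n : ℕ, (κ : Measure (ι → ℝ)) {s | ∃ i, s i < 0} ≤
        (((((Φ fun _ => ε / 2) + 1) * Real.exp (-(ε / 2 * n))).toNNReal : ℝ≥0) : ℝ≥0∞) := fun n => by
      calc (κ : Measure (ι → ℝ)) {s | ∃ i, s i < 0}
            ≤ (κ : Measure (ι → ℝ)) {s : ι → ℝ | (∀ i, 0 ≤ s i) ∧ ∑ i, s i ≤ (n : ℝ)}ᶜ :=
            measure_mono fun s ⟨i, hi⟩ hsK => absurd (hsK.1 i) (not_le.2 hi)
        _ = ((κ {s : ι → ℝ | (∀ i, 0 ≤ s i) ∧ ∑ i, s i ≤ (n : ℝ)}ᶜ : ℝ≥0) : ℝ≥0∞) :=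
            (FiniteMeasure.ennreal_coeFn_eq_coeFn_toMeasure κ _).symm
        _ ≤ _ := ENNReal.coe_le_coe.2 (hκ.2 n)
    have h2 : Tendsto (fun n : ℕ =>
        (((((Φ fun _ => ε / 2) + 1) * Real.exp (-(ε / 2 * n))).toNNReal : ℝ≥0) : ℝ≥0∞))
        atTop (𝓝 0) := by
      rw [← ENNReal.coe_zero]; exact ENNReal.tendsto_coe.2 hu
    exact le_antisymm (ge_of_tendsto' h2 h1) bot_le

end Limit

/-! ## Floor arithmetic for the lattice approximation of a dilated point -/

/-- Dilating by `c ≥ 1` before taking integer parts at mesh `δ ≤ (c-1)|t|` does not decrease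
`|t/δ|`. [folklore] -/
theorem abs_div_le_abs_floor {t c δ : ℝ} (hδ : 0 < δ) (hc : 1 ≤ c)
    (h : t ≠ 0 → δ ≤ (c - 1) * |t|) : |t / δ| ≤ |((⌊c * t / δ⌋ : ℤ) : ℝ)| := by
  rcases lt_trichotomy t 0 with ht | rfl | ht
  · have h1 : ((⌊c * t / δ⌋ : ℤ) : ℝ) ≤ c * t / δ := Int.floor_le _
    have h2 : c * t / δ ≤ t / δ := div_le_div_of_nonneg_right (by nlinarith) hδ.le
    have h3 : t / δ < 0 := div_neg_of_neg_of_pos ht hδ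
    rw [abs_of_neg h3, abs_of_neg (by linarith)]
    linarith
  · simp
  · have hδ' := h ht.ne'
    rw [abs_of_pos ht] at hδ'
    have h1 : c * t / δ < ((⌊c * t / δ⌋ : ℤ) : ℝ) + 1 := Int.lt_floor_add_one _
    have h2 : 1 ≤ (c - 1) * t / δ := by rw [le_div_iff₀ hδ, one_mul]; exact hδ'
    have h3 : 0 < t / δ := div_pos ht hδ
    have h4 : (c - 1) * t / δ = c * t / δ - t / δ := by ring
    rw [abs_of_pos h3, abs_of_pos (by linarith)]
    linarith

/-- Contracting by `0 < c ≤ 1` before taking integer parts at mesh `δ ≤ (1-c)|t|` does not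
increase `|t/δ|`. [folklore] -/
theorem abs_floor_le_abs_div {t c δ : ℝ} (hδ : 0 < δ) (hc0 : 0 < c) (hc : c ≤ 1)
    (h : t ≠ 0 → δ ≤ (1 - c) * |t|) : |((⌊c * t / δ⌋ : ℤ) : ℝ)| ≤ |t / δ| := by
  rcases lt_trichotomy t 0 with ht | rfl | ht
  · have hδ' := h ht.ne
    rw [abs_of_neg ht] at hδ'
    have h1 : c * t / δ < ((⌊c * t / δ⌋ : ℤ) : ℝ) + 1 := Int.lt_floor_add_one _
    have h0 : ((⌊c * t / δ⌋ : ℤ) : ℝ) ≤ c * t / δ := Int.floor_le _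
    have h2 : c * t / δ < 0 := div_neg_of_neg_of_pos (by nlinarith) hδ
    have h3 : 1 ≤ (1 - c) * (-t) / δ := by rw [le_div_iff₀ hδ, one_mul]; exact hδ'
    have h4 : t / δ < 0 := div_neg_of_neg_of_pos ht hδ
    have h5 : (1 - c) * (-t) / δ = c * t / δ - t / δ := by ring
    rw [abs_of_neg (by linarith), abs_of_neg h4]
    linarith
  · simp
  · have h0 : (0 : ℝ) ≤ ((⌊c * t / δ⌋ : ℤ) : ℝ) := by
      exact_mod_cast Int.floor_nonneg.2 (by positivity)
    have h1 : ((⌊c * t / δ⌋ : ℤ) : ℝ) ≤ c * t / δ := Int.floor_le _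
    have h2 : c * t / δ ≤ t / δ := div_le_div_of_nonneg_right (by nlinarith) hδ.le
    rw [abs_of_nonneg h0, abs_of_pos (div_pos ht hδ)]
    linarith

/-- A positive lower bound for the nonzero coordinates of a vector. [folklore] -/
theorem exists_pos_le_abs_of_ne_zero (x : ι → ℝ) :
    ∃ m : ℝ, 0 < m ∧ ∀ i, x i ≠ 0 → m ≤ |x i| := by
  have hnn : ∀ j, 0 ≤ 1 / |x j| := fun j => div_nonneg zero_le_one (abs_nonneg _)
  have hpos : 0 < 1 + ∑ j, 1 / |x j| :=
    add_pos_of_pos_of_nonneg one_pos (Finset.sum_nonneg fun j _ => hnn j)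
  refine ⟨1 / (1 + ∑ j, 1 / |x j|), one_div_pos.2 hpos, fun i hi => ?_⟩
  have hxi : 0 < |x i| := abs_pos.2 hi
  have hle : 1 / |x i| ≤ 1 + ∑ j, 1 / |x j| := by
    have : 1 / |x i| ≤ ∑ j, 1 / |x j| :=
      Finset.single_le_sum (f := fun j => 1 / |x j|) (fun j _ => hnn j) (Finset.mem_univ i)
    linarith
  calc 1 / (1 + ∑ j, 1 / |x j|) ≤ 1 / (1 / |x i|) :=
      one_div_le_one_div_of_le (one_div_pos.2 hxi) hle
    _ = |x i| := one_div_one_div _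

end Summit.CriticalPhenomena.Ising3DConformalLimit.Theorems.LimitKernelGSM

end
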